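import Summits.BirchSwinnertonDyer.BirchSwinnertonDyer.Theorems.GenusKolyvaginAtTwoGenusPrimitiveSupplyAtTwoTwistingPrimeLevelFour
import HarnessLib

/-!
# Route `GenusKolyvaginAtTwo`, crux #2 `GenusPrimitiveSupplyAtTwo` (stmt-BirchSwinnertonDyer-22136):
# the level-`4` theorem for the TWIN — classes of a twist, the point condition, the depth-`M` capstone for every `M`

Width seat `bsd-line-gk2-p4` g10, cell `bsd-f1-sign2`; helper (`--supports stmt-BirchSwinnertonDyer-22136`), §45 of
the twisting-prime series (after `…TwistingPrimeLevelFour`). THEOREMS ONLY: no definition, no named fact, no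
`sorry`; no item is closed; BSD is not proved by any of this.

* `forall_torsionFixing_four_h1Eval_eq_zero_of_forall_torsionFixing_pow_twist` /
  `forall_torsionFixing_pow_h1Eval_eq_zero_iff_forall_torsionFixing_four`: for any elliptic model `Wd` of a twist
  `W^{(d)}` (transport along `Wd[2] ≅ W[2]`), a class of `H¹(ℚ, Wd[2])` dies on `Γ_{ℚ(E[2^M])}` (`E = W`, `M ≥ 2`,
  `2`-adic tower of `W` onto) IFF it dies on `Γ_{ℚ(E[4])}`.
* `exists_torsionFixing_pow_smul_ne_of_exists_torsionFixing_four_smul_ne` / `…_iff_…`: for `Q ∈ Wd(ℚ̄)` with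
  `2Q` rational, «some `h ∈ Γ_{ℚ(E[2^M])}` moves `Q`» ⟺ «some `h ∈ Γ_{ℚ(E[4])}` moves `Q`» — the twin's point
  condition of the depth-`M` supply (g8/g9: «the generator of `A(ℚ)/2` is not halvable over `ℚ(E[2^M])`») is the
  LEVEL-`4` condition «not halvable over `ℚ(E[4])`» (MEMO-es §13's test; census DES13 508/510) for EVERY `M`.
* `exists_kolyvaginPrime_pow_genusPair_selmer_of_cor34i_of_half_four_of_habitat`: the depth-`M` habitat capstone
  (ℓ ≡ 7 (8), Kolyvagin of depth `M`: `2^M ∣ ℓ + 1`, `2^M ∣ a_ℓ`, genus pair `#Sel₂ = (2, 1)`) for EVERY `M ≥ 1`,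
  modulo cor34i (PRINT; replaceable by {PT, Tate χ} via gk2-p5 p624297) and the twin's LEVEL-`4` point condition
  only — g8's `…_depthTwo_…_of_habitat` was the case `M = 2`.

So for the line: deeper Kolyvagin primes (depth `M = M₀ + 1 ≥ 3` on WALL row 1, where `16 ∣ Ш_an` forces
`M₀ ≥ 2`) meet NO entanglement obstruction beyond the level-`4` one already censused; the DES13 exceptions
(2/510) are the only ones at every depth. BSD is not proved by this; U (24947) is untouched.

References: [LawsonWuthrich2016] §3; [MazurRubin2010] Cor. 3.4 (i), Prop. 3.3, Lemma 3.5, Remark 2.4;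
[GrossLMS1991] §3 (3.1)–(3.3), §9 Prop. 9.1.
-/

set_option linter.dupNamespace false -- tree convention: `Summit.BirchSwinnertonDyer.BirchSwinnertonDyer.Theorems` (summit = sub-problem)
set_option autoImplicit false

noncomputable section

open scoped Classical Pointwise

namespace Summit.BirchSwinnertonDyer.BirchSwinnertonDyer.Theorems.GenusKolyTwistingPrime

open WeierstrassCurve NumberField IsDedekindDomain Field
open Literature.NumberTheory.GaloisRepresentations Literature.NumberTheory.EllipticCurves
open Literature.NumberTheory Matrix

/-! ## §45 Consequences for the twin: classes of a twist, the point condition, the depth-`M` capstone -/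

section Twin

variable (W : WeierstrassCurve ℚ) [W.IsElliptic] {K : Type} [Field K] [NumberField K]

/-- **The level-`4` theorem for classes of a TWIST** `Wd ≅ W^{(d)}` (transport along the equivariant
identification `Wd[2] ≅ W[2]`, g7 `exists_equivariant_addEquiv_geomTorsion_two_of_twist` /
`exists_h1Map_of_equivariant_addEquiv`): a class of `H¹(ℚ, Wd[2])` dying on `Γ_{ℚ(E[2^M])}` (`E = W`, `M ≥ 2`,
`2`-adic tower of `W` onto) dies on `Γ_{ℚ(E[4])}`. [cite: LawsonWuthrich2016, §3] [cite: MazurRubin2010, Remark 2.4] -/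
theorem forall_torsionFixing_four_h1Eval_eq_zero_of_forall_torsionFixing_pow_twist
    (hρ : ∀ n : ℕ, 0 < n → W.HasSurjectiveModNGaloisRep ((2 : ℤ) ^ n)) {M : ℕ} (hM : 2 ≤ M)
    {d : ℚ} (hd : d ≠ 0) {Wd : WeierstrassCurve ℚ} [Wd.IsElliptic] {C : VariableChange ℚ}
    (hWd : C • W.quadraticTwist d = Wd) {x : galH1Torsion Wd (2 : ℤ)}
    (hx : ∀ h ∈ torsionFixing W ((2 ^ M : ℕ) : ℤ), h1Eval Wd (2 : ℤ) x h = 0) :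
    ∀ h ∈ torsionFixing W (4 : ℤ), h1Eval Wd (2 : ℤ) x h = 0 := by
  obtain ⟨ψ, hψ⟩ := exists_equivariant_addEquiv_geomTorsion_two_of_twist W hd hWd
  obtain ⟨Ψ, -, hΨeval, -⟩ := exists_h1Map_of_equivariant_addEquiv Wd W (2 : ℤ) ψ hψ
  have hTd : torsionFixing W (2 : ℤ) ≤ torsionFixing Wd (2 : ℤ) :=
    torsionFixing_le_of_equivariant_addEquiv Wd W (2 : ℤ) ψ hψ
  have h2M : (2 : ℤ) ∣ ((2 ^ M : ℕ) : ℤ) := by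
    rw [Nat.cast_pow, Nat.cast_ofNat]; exact dvd_pow_self 2 (by omega : M ≠ 0)
  have hTM : torsionFixing W ((2 ^ M : ℕ) : ℤ) ≤ torsionFixing W (2 : ℤ) :=
    KolyvaginLowerBoundAtTwo.torsionFixing_le_of_dvd W h2M
  have hT4 : torsionFixing W (4 : ℤ) ≤ torsionFixing W (2 : ℤ) :=
    KolyvaginLowerBoundAtTwo.torsionFixing_le_of_dvd W (by norm_num)
  have hΨx : ∀ h ∈ torsionFixing W ((2 ^ M : ℕ) : ℤ), h1Eval W (2 : ℤ) (Ψ x) h = 0 := by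
    intro h hh
    rw [hΨeval x (hTM hh) (hTd (hTM hh)), hx h hh, map_zero]
  intro h hh
  have h0 := forall_torsionFixing_four_h1Eval_eq_zero_of_forall_torsionFixing_pow W hρ hM hΨx h hh
  rw [hΨeval x (hT4 hh) (hTd (hT4 hh))] at h0
  exact (map_eq_zero_iff ψ ψ.injective).mp h0

/-- **Dying on `Γ_{ℚ(E[2^M])}` ⟺ dying on `Γ_{ℚ(E[4])}`** for classes of any twist `Wd ≅ W^{(d)}` (`d ≠ 0`;
`Wd = W` allowed via `d = 1`), `M ≥ 2`, `2`-adic tower of `W` onto. [cite: LawsonWuthrich2016, §3] -/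
theorem forall_torsionFixing_pow_h1Eval_eq_zero_iff_forall_torsionFixing_four
    (hρ : ∀ n : ℕ, 0 < n → W.HasSurjectiveModNGaloisRep ((2 : ℤ) ^ n)) {M : ℕ} (hM : 2 ≤ M)
    {d : ℚ} (hd : d ≠ 0) {Wd : WeierstrassCurve ℚ} [Wd.IsElliptic] {C : VariableChange ℚ}
    (hWd : C • W.quadraticTwist d = Wd) (x : galH1Torsion Wd (2 : ℤ)) :
    (∀ h ∈ torsionFixing W ((2 ^ M : ℕ) : ℤ), h1Eval Wd (2 : ℤ) x h = 0) ↔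
      ∀ h ∈ torsionFixing W (4 : ℤ), h1Eval Wd (2 : ℤ) x h = 0 := by
  have h4M : torsionFixing W ((2 ^ M : ℕ) : ℤ) ≤ torsionFixing W (4 : ℤ) :=
    KolyvaginLowerBoundAtTwo.torsionFixing_le_of_dvd W (by
      rw [Nat.cast_pow, Nat.cast_ofNat, show (4 : ℤ) = 2 ^ 2 by norm_num]; exact pow_dvd_pow 2 hM)
  exact ⟨forall_torsionFixing_four_h1Eval_eq_zero_of_forall_torsionFixing_pow_twist W hρ hM hd hWd,
    fun h4 h hh ↦ h4 h (h4M hh)⟩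

/-- **Selmer-level form** (g8/g9's non-entanglement hypothesis «some class of `Sel₂(Wd)` does not die on
`Γ_{ℚ(E[2^M])}`» is LEVEL-INDEPENDENT from `M = 2` on): for any elliptic model `Wd` of a twist of `W`, `M ≥ 2`,
`2`-adic tower of `W` onto, SOME Selmer class of `Wd` survives on `Γ_{ℚ(E[2^M])}` IFF some Selmer class survives on
`Γ_{ℚ(E[4])}`. [cite: LawsonWuthrich2016, §3] [cite: MazurRubin2010, Remark 2.4] -/
theorem exists_selmer_h1Eval_ne_pow_iff_exists_selmer_h1Eval_ne_four
    (hρ : ∀ n : ℕ, 0 < n → W.HasSurjectiveModNGaloisRep ((2 : ℤ) ^ n)) {M : ℕ} (hM : 2 ≤ M)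
    {d : ℚ} (hd : d ≠ 0) {Wd : WeierstrassCurve ℚ} [Wd.IsElliptic] {C : VariableChange ℚ}
    (hWd : C • W.quadraticTwist d = Wd) :
    (∃ c ∈ Wd.selmerGroup 2, ∃ h ∈ torsionFixing W ((2 ^ M : ℕ) : ℤ), h1Eval Wd (2 : ℤ) c h ≠ 0) ↔
      ∃ c ∈ Wd.selmerGroup 2, ∃ h ∈ torsionFixing W (4 : ℤ), h1Eval Wd (2 : ℤ) c h ≠ 0 := by
  have h4M : torsionFixing W ((2 ^ M : ℕ) : ℤ) ≤ torsionFixing W (4 : ℤ) :=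
    KolyvaginLowerBoundAtTwo.torsionFixing_le_of_dvd W (by
      rw [Nat.cast_pow, Nat.cast_ofNat, show (4 : ℤ) = 2 ^ 2 by norm_num]; exact pow_dvd_pow 2 hM)
  constructor
  · rintro ⟨c, hc, h, hh, hne⟩
    exact ⟨c, hc, h, h4M hh, hne⟩
  · rintro ⟨c, hc, h, hh, hne⟩
    refine ⟨c, hc, ?_⟩
    by_contra hcon
    push Not at hcon
    exact hne ((forall_torsionFixing_pow_h1Eval_eq_zero_iff_forall_torsionFixing_four W hρ hM hd hWd c).mp hcon h hh)

/-- **THE TWIN'S POINT CONDITION IS THE LEVEL-`4` ONE.** For `Q ∈ Wd(ℚ̄)` with `2Q` rational (`Wd` a twist of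
`W`, `2`-adic tower of `W` onto): if some element of `Γ_{ℚ(E[4])}` moves `Q` then, for EVERY `M ≥ 1`, some
element of `Γ_{ℚ(E[2^M])}` moves `Q` («`2Q` not halvable over `ℚ(E[4])` ⟹ not halvable over any `ℚ(E[2^M])`»:
the Kummer class `[σ ↦ σQ − Q]` would otherwise die on `Γ_{ℚ(E[2^M])}`, hence on `Γ_{ℚ(E[4])}`).
[cite: LawsonWuthrich2016, §3] [cite: GrossLMS1991, §9 Prop. 9.1] -/
theorem exists_torsionFixing_pow_smul_ne_of_exists_torsionFixing_four_smul_ne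
    (hρ : ∀ n : ℕ, 0 < n → W.HasSurjectiveModNGaloisRep ((2 : ℤ) ^ n))
    {d : ℚ} (hd : d ≠ 0) {Wd : WeierstrassCurve ℚ} [Wd.IsElliptic] {C : VariableChange ℚ}
    (hWd : C • W.quadraticTwist d = Wd)
    (Q : geomPoints Wd) (hQ : (2 : ℤ) • Q ∈ MulAction.fixedPoints (absoluteGaloisGroup ℚ) (geomPoints Wd))
    (hmove : ∃ h ∈ torsionFixing W (4 : ℤ), h • Q ≠ Q) {M : ℕ} (hM : 1 ≤ M) :
    ∃ h ∈ torsionFixing W ((2 ^ M : ℕ) : ℤ), h • Q ≠ Q := by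
  by_contra hcon
  push Not at hcon
  obtain ⟨ψ, hψ⟩ := exists_equivariant_addEquiv_geomTorsion_two_of_twist W hd hWd
  have hTd : torsionFixing W (2 : ℤ) ≤ torsionFixing Wd (2 : ℤ) :=
    torsionFixing_le_of_equivariant_addEquiv Wd W (2 : ℤ) ψ hψ
  have hT4 : torsionFixing W (4 : ℤ) ≤ torsionFixing W (2 : ℤ) :=
    KolyvaginLowerBoundAtTwo.torsionFixing_le_of_dvd W (by norm_num)
  obtain ⟨h, hh, hne⟩ := hmove
  rcases Nat.exists_eq_add_of_le hM with ⟨j, rfl⟩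
  rcases j with _ | j
  · -- `M = 1`: `Γ_{ℚ(E[4])} ⊆ Γ_{ℚ(E[2])}`
    have h21 : torsionFixing W (4 : ℤ) ≤ torsionFixing W ((2 ^ (1 + 0) : ℕ) : ℤ) :=
      KolyvaginLowerBoundAtTwo.torsionFixing_le_of_dvd W (by norm_num)
    exact hne (hcon h (h21 hh))
  · -- `M ≥ 2`: the Kummer class of `Q` dies on `Γ_{ℚ(E[2^M])}`, hence on `Γ_{ℚ(E[4])}`
    have h2M : (2 : ℤ) ∣ ((2 ^ (1 + (j + 1)) : ℕ) : ℤ) := by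
      rw [Nat.cast_pow, Nat.cast_ofNat]; exact dvd_pow_self 2 (by omega)
    have hTM : torsionFixing W ((2 ^ (1 + (j + 1)) : ℕ) : ℤ) ≤ torsionFixing W (2 : ℤ) :=
      KolyvaginLowerBoundAtTwo.torsionFixing_le_of_dvd W h2M
    have hκM : ∀ g ∈ torsionFixing W ((2 ^ (1 + (j + 1)) : ℕ) : ℤ),
        h1Eval Wd (2 : ℤ) (Wd.kummerClassTorsion (2 : ℤ) Q hQ) g = 0 := by
      intro g hg
      rw [← ZeroMemClass.coe_eq_zero, coe_h1Eval_kummerClassTorsion Wd (2 : ℤ) Q hQ (hTd (hTM hg)), hcon g hg,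
        sub_self]
    have hκ4 := forall_torsionFixing_four_h1Eval_eq_zero_of_forall_torsionFixing_pow_twist W hρ (by omega) hd hWd hκM
    apply hne
    have h0 := hκ4 h hh
    rw [← ZeroMemClass.coe_eq_zero, coe_h1Eval_kummerClassTorsion Wd (2 : ℤ) Q hQ (hTd (hT4 hh)), sub_eq_zero] at h0
    exact h0

/-- **… and conversely (trivially), so the point condition is LEVEL-INDEPENDENT from `M = 2` on**:
«some `h ∈ Γ_{ℚ(E[2^M])}` moves `Q`» ⟺ «some `h ∈ Γ_{ℚ(E[4])}` moves `Q`» (`M ≥ 2`). [cite: LawsonWuthrich2016, §3] -/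
theorem exists_torsionFixing_pow_smul_ne_iff_exists_torsionFixing_four_smul_ne
    (hρ : ∀ n : ℕ, 0 < n → W.HasSurjectiveModNGaloisRep ((2 : ℤ) ^ n))
    {d : ℚ} (hd : d ≠ 0) {Wd : WeierstrassCurve ℚ} [Wd.IsElliptic] {C : VariableChange ℚ}
    (hWd : C • W.quadraticTwist d = Wd)
    (Q : geomPoints Wd) (hQ : (2 : ℤ) • Q ∈ MulAction.fixedPoints (absoluteGaloisGroup ℚ) (geomPoints Wd))
    {M : ℕ} (hM : 2 ≤ M) :
    (∃ h ∈ torsionFixing W ((2 ^ M : ℕ) : ℤ), h • Q ≠ Q) ↔ ∃ h ∈ torsionFixing W (4 : ℤ), h • Q ≠ Q := by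
  have h4M : torsionFixing W ((2 ^ M : ℕ) : ℤ) ≤ torsionFixing W (4 : ℤ) :=
    KolyvaginLowerBoundAtTwo.torsionFixing_le_of_dvd W (by
      rw [Nat.cast_pow, Nat.cast_ofNat, show (4 : ℤ) = 2 ^ 2 by norm_num]; exact pow_dvd_pow 2 hM)
  exact ⟨fun ⟨h, hh, hne⟩ ↦ ⟨h, h4M hh, hne⟩,
    fun hmove ↦ exists_torsionFixing_pow_smul_ne_of_exists_torsionFixing_four_smul_ne W hρ hd hWd Q hQ hmove
      (by omega)⟩

/-- **DEPTH-`M` SUPPLY OF THE AUXILIARY-FIELD FORM ON THE HABITAT, for EVERY `M ≥ 1`, modulo cor34i and the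
twin's LEVEL-`4` point condition ONLY.** `W/ℚ` globally minimal, `Δ(W) < 0`, `2`-adic tower of `W` onto,
`#Sel₂(W) = 4`; `K` imaginary quadratic; `Wd` a globally minimal model of `W^{(d_K)}` with `#Sel₂(Wd) = 2`; a
rational `P ∈ Wd(ℚ)` with a half `Q` moved by SOME element of `Γ_{ℚ(E[4])}`. Then for every `M ≥ 1`, beyond
every finite `B₀`: a prime `ℓ ≡ 7 (mod 8)`, Kolyvagin for `(E, K, 2)` of DEPTH `M` (`FrobEqFrobInfty W K (2^M) ℓ`,
`2^M ∣ ℓ + 1`, `2^M ∣ a_ℓ(W)`), with every elliptic model of `W^{(−ℓ)}` having `#Sel₂ = 2` and every elliptic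
model of `Wd^{(−ℓ)}` having `#Sel₂ = 1`. Both depth-`M` hypotheses of g8's
`exists_kolyvaginPrime_pow_genusPair_selmer_of_cor34i_of_half` are discharged from level `4`:
the `W`-side one by `exists_selmer_h1Eval_ne_pow_of_card_eq_four`, the twin's by
`exists_torsionFixing_pow_smul_ne_of_exists_torsionFixing_four_smul_ne`. (g8's `…_depthTwo_…_of_habitat` is
the case `M = 2`.) BSD is not proved by this. [cite: MazurRubin2010, Cor. 3.4 (i), Prop. 3.3, Lemma 3.5]
[cite: LawsonWuthrich2016, §3] [cite: GrossLMS1991, §3 (3.1)–(3.3), §9 Prop. 9.1] -/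
theorem exists_kolyvaginPrime_pow_genusPair_selmer_of_cor34i_of_half_four_of_habitat
    (h34 : MazurRubin2010.cor34i_singleton_rat)
    (hρ : ∀ n : ℕ, 0 < n → W.HasSurjectiveModNGaloisRep ((2 : ℤ) ^ n)) [W.IsGloballyMinimal] (hΔ : W.Δ < 0)
    (h4 : Nat.card (W.selmerGroup 2) = 4)
    (hK : IsImaginaryQuadratic K) {Wd : WeierstrassCurve ℚ} [Wd.IsElliptic] [Wd.IsGloballyMinimal]
    {C : VariableChange ℚ} (hWd : C • W.quadraticTwist (discr K : ℚ) = Wd)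
    (h2 : Nat.card (Wd.selmerGroup 2) = 2)
    (P : Wd.toAffine.Point) (Q : geomPoints Wd) (hQ : (2 : ℤ) • Q = toGeomPoints Wd P)
    (hmove : ∃ h ∈ torsionFixing W (4 : ℤ), h • Q ≠ Q) {M : ℕ} (hM : 1 ≤ M) (B₀ : Finset ℕ) :
    ∃ ℓ : ℕ, ∃ _ : Fact ℓ.Prime, ℓ ∉ B₀ ∧ ℓ % 8 = 7 ∧ IsKolyvaginPrime (W.conductorNorm ℤ) W K 2 ℓ ∧
      FrobEqFrobInfty W K (2 ^ M) ℓ ∧ 2 ^ M ∣ ℓ + 1 ∧ ((2 : ℤ) ^ M) ∣ W.frobeniusTrace ℓ ∧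
      (∀ (W₁ : WeierstrassCurve ℚ) [W₁.IsElliptic],
        (∃ C₁ : VariableChange ℚ, C₁ • W.quadraticTwist (-(ℓ : ℚ)) = W₁) →
          Nat.card (W₁.selmerGroup 2) = 2) ∧
      (∀ (W₂ : WeierstrassCurve ℚ) [W₂.IsElliptic],
        (∃ C₂ : VariableChange ℚ, C₂ • Wd.quadraticTwist (-(ℓ : ℚ)) = W₂) →
          Nat.card (W₂.selmerGroup 2) = 1) := by
  have hsurj : W.HasSurjectiveModNGaloisRep 2 := by simpa using hρ 1 one_pos
  have hd0 : (discr K : ℚ) ≠ 0 := by exact_mod_cast NumberField.discr_ne_zero K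
  have hQfix : (2 : ℤ) • Q ∈ MulAction.fixedPoints (absoluteGaloisGroup ℚ) (geomPoints Wd) := by
    rw [hQ]; exact WeierstrassCurve.toGeomPoints_mem_fixedPoints Wd P
  exact exists_kolyvaginPrime_pow_genusPair_selmer_of_cor34i_of_half W h34 hsurj hΔ h4 hK hWd h2 hM
    (exists_selmer_h1Eval_ne_pow_of_card_eq_four W hρ h4 M) P Q hQ
    (exists_torsionFixing_pow_smul_ne_of_exists_torsionFixing_four_smul_ne W hρ hd0 hWd Q hQfix hmove hM) B₀

end Twin

end Summit.BirchSwinnertonDyer.BirchSwinnertonDyer.Theorems.GenusKolyTwistingPrime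

end
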